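import Literature.NumberTheory.EllipticCurves.CongruentNumberMonskySelmerParitySelmer
import Literature.NumberTheory.EllipticCurves.Wiles2000CongruentProofs
import HarnessLib

/-!
# The `2`-torsion of `Ш(E_N)` against Monsky's `s(N)`: `#Ш(E_N)[2] = 2^{s(N) − rk E_N(ℚ)}`, and on `s(N) = 1`
# (`#Sel⁽²⁾(E_N/ℚ) = 8`) «`N` is a congruent number ⟺ `Ш(E_N)[2] = 0` ⟺ `Ш(E_N)[2^∞] = 0`» — unconditionally

Heath-Brown, *The size of Selmer groups for the congruent number problem, II*, Invent. Math. 118 (1994), §1 (typescript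
p. 1 L14–L20): "`#S⁽²⁾(E_D) = 2^{2+s(D)}` … the rank `r(D)` satisfies `r(D) ≤ s(D)` … with `2^{s(D)−r(D)} = #Ш(E_D)[2]`"
(the descent count, Silverman AEC Thm. X.4.2: `#Sel⁽²⁾ = 2^{rk}·#E(ℚ)[2]·#Ш[2]` with `#E_N(ℚ)[2] = 4`). With Monsky's
formula a theorem of the tree WITH EQUALITY for every square-free `N` (`MonskySelmerParity.exists_card_selmerGroup_two_eq_pow`)
this file records the exact dictionary between `s(N)`, the rank and `Ш[2]`:
* `#(Ш(E_N) ⊓ H¹(ℚ,E_N)[2]) = 2^{s − rk}` and `rk ≤ s` whenever `#Sel⁽²⁾(E_N/ℚ) = 2^{2+s}` (`natCard_sha_two_eq_pow_sub`);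
  `Ш[2] = 0 ⟺ rk = s` (`sha_two_eq_bot_iff_mordellWeilRank_eq`);
* on `s(N) = 1`, i.e. `#Sel⁽²⁾(E_N/ℚ) = 8` — Monsky's sixteen families of Thms. 5.13/5.14 (Remark (2), p. 67: «`S̄ = ℤ/2`»),
  the whole even-five family `2p₅q₃` (`P2/CongruentNumberEvenFiveSelmerExact.lean`), every `s(n) = 1` cell of the census —
  exactly one of «`rk = 1 ∧ Ш[2] = 0`», «`rk = 0 ∧ #Ш[2] = 2`» holds, so **`N` is a congruent number iff `Ш(E_N)[2] = 0` iff
  `Ш(E_N)[2^∞] = 0`**, and a non-congruent `N` with `s(N) = 1` has `#Ш(E_N)[2] = 2` (Top–Yui's dictionary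
  `rk ≠ 0 ⟺ N congruent`, tree `Wiles2000.mordellWeilRank_ne_zero_iff_isCongruentNumber`).
Everything is unconditional (axioms standard); no L-function, no display, no named fact. Cell `bsd-monsky` (prover-A g10).
[cite: HeathBrown1994SelmerCongruentII, §1 typescript p. 1 L14–L20] [cite: SilvermanAEC2009, Thm. X.4.2]
[cite: Monsky1990MockHeegner, Remark (2) (p. 67)] [cite: TopYui2008Congruent, Prop. 3.3 (i) ⟺ (iv)]
-/

noncomputable section

open scoped Classical

open WeierstrassCurve

namespace Literature.NumberTheory.EllipticCurves

namespace SelmerEightShaTwo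

variable {N : ℕ}

/-! ## §1 `#Ш(E_N)[2] = 2^{s − rk}` and `rk ≤ s` from `#Sel⁽²⁾ = 2^{2+s}` -/

/-- **`rk E_N(ℚ) ≤ s` and `#(Ш(E_N) ⊓ H¹[2]) = 2^{s − rk}`** whenever `#Sel⁽²⁾(E_N/ℚ) = 2^{2+s}`: from the descent
count `#Ш[2]·2^{rk} = 2^s` (`MonskySelmerParity.natCard_sha_two_mul_pow_rank_eq`).
[cite: HeathBrown1994SelmerCongruentII, §1 typescript p. 1 L14–L20] [cite: SilvermanAEC2009, Thm. X.4.2] -/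
theorem natCard_sha_two_eq_pow_sub (hN : N ≠ 0) {s : ℕ}
    (hs : Nat.card ((congruentNumberCurve N).selmerGroup 2) = 2 ^ (2 + s)) :
    haveI := isElliptic_congruentNumberCurve hN
    (congruentNumberCurve N).mordellWeilRank ≤ s ∧
      Nat.card ((congruentNumberCurve N).sha ⊓ AddSubgroup.torsionBy (congruentNumberCurve N).galH1 2 :
        AddSubgroup (congruentNumberCurve N).galH1) = 2 ^ (s - (congruentNumberCurve N).mordellWeilRank) := by
  haveI := isElliptic_congruentNumberCurve hN
  have h := MonskySelmerParity.natCard_sha_two_mul_pow_rank_eq hN hs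
  generalize (congruentNumberCurve N).mordellWeilRank = r at h ⊢
  generalize Nat.card ((congruentNumberCurve N).sha ⊓ AddSubgroup.torsionBy (congruentNumberCurve N).galH1 2 :
        AddSubgroup (congruentNumberCurve N).galH1) = S at h ⊢
  have hdvd : 2 ^ r ∣ 2 ^ s := ⟨S, by rw [← h, mul_comm]⟩
  have hrs : r ≤ s := (Nat.pow_dvd_pow_iff_le_right (by norm_num)).mp hdvd
  refine ⟨hrs, ?_⟩
  have h2 : S * 2 ^ r = 2 ^ (s - r) * 2 ^ r := by
    rw [h, ← pow_add, Nat.sub_add_cancel hrs]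
  exact Nat.eq_of_mul_eq_mul_right (by positivity) h2

/-- **`Ш(E_N)[2] = 0 ⟺ rk E_N(ℚ) = s`** whenever `#Sel⁽²⁾(E_N/ℚ) = 2^{2+s}` (the `2`-descent is sharp exactly when
`Ш[2]` vanishes). [cite: HeathBrown1994SelmerCongruentII, §1 typescript p. 1 L14–L20] [cite: SilvermanAEC2009, Thm. X.4.2] -/
theorem sha_two_eq_bot_iff_mordellWeilRank_eq (hN : N ≠ 0) {s : ℕ}
    (hs : Nat.card ((congruentNumberCurve N).selmerGroup 2) = 2 ^ (2 + s)) :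
    haveI := isElliptic_congruentNumberCurve hN
    ((congruentNumberCurve N).sha ⊓ AddSubgroup.torsionBy (congruentNumberCurve N).galH1 2 :
        AddSubgroup (congruentNumberCurve N).galH1) = ⊥ ↔ (congruentNumberCurve N).mordellWeilRank = s := by
  haveI := isElliptic_congruentNumberCurve hN
  obtain ⟨hrs, hcard⟩ := natCard_sha_two_eq_pow_sub hN hs
  constructor
  · intro hbot
    rw [hbot, AddSubgroup.card_bot] at hcard
    have : s - (congruentNumberCurve N).mordellWeilRank = 0 := by
      by_contra hne
      have h1 : 2 ≤ 2 ^ (s - (congruentNumberCurve N).mordellWeilRank) :=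
        calc 2 = 2 ^ 1 := by norm_num
          _ ≤ 2 ^ (s - (congruentNumberCurve N).mordellWeilRank) :=
            Nat.pow_le_pow_right (by norm_num) (Nat.one_le_iff_ne_zero.mpr hne)
      omega
    omega
  · intro hr
    rw [hr, Nat.sub_self, pow_zero] at hcard
    exact AddSubgroup.eq_bot_of_card_eq _ hcard

/-! ## §2 `s(N) = 1`: `#Sel⁽²⁾(E_N/ℚ) = 8` -/

/-- **`#Sel⁽²⁾(E_N/ℚ) = 8`: exactly one of «`rk = 1 ∧ #Ш[2] = 1`», «`rk = 0 ∧ #Ш[2] = 2`»** (`#Ш[2]·2^{rk} = 2`).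
[cite: SilvermanAEC2009, Thm. X.4.2] [cite: Monsky1990MockHeegner, Remark (2) (p. 67)] -/
theorem mordellWeilRank_card_sha_two_cases_of_card_selmerGroup_two_eq_eight (hN : N ≠ 0)
    (h8 : Nat.card ((congruentNumberCurve N).selmerGroup 2) = 8) :
    haveI := isElliptic_congruentNumberCurve hN
    ((congruentNumberCurve N).mordellWeilRank = 1 ∧
      Nat.card ((congruentNumberCurve N).sha ⊓ AddSubgroup.torsionBy (congruentNumberCurve N).galH1 2 :
        AddSubgroup (congruentNumberCurve N).galH1) = 1) ∨
    ((congruentNumberCurve N).mordellWeilRank = 0 ∧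
      Nat.card ((congruentNumberCurve N).sha ⊓ AddSubgroup.torsionBy (congruentNumberCurve N).galH1 2 :
        AddSubgroup (congruentNumberCurve N).galH1) = 2) := by
  haveI := isElliptic_congruentNumberCurve hN
  have hs : Nat.card ((congruentNumberCurve N).selmerGroup 2) = 2 ^ (2 + 1) := by rw [h8]; norm_num
  obtain ⟨hrs, hcard⟩ := natCard_sha_two_eq_pow_sub hN hs
  rcases Nat.le_one_iff_eq_zero_or_eq_one.mp hrs with hr | hr
  · right
    refine ⟨hr, ?_⟩
    rw [hcard, hr]
    norm_num
  · left
    refine ⟨hr, ?_⟩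
    rw [hcard, hr]
    norm_num

/-- **`#Sel⁽²⁾(E_N/ℚ) = 8`: `rk E_N(ℚ) = 1 ⟺ Ш(E_N)[2] = 0`.** [cite: SilvermanAEC2009, Thm. X.4.2] -/
theorem mordellWeilRank_eq_one_iff_sha_two_eq_bot_of_card_selmerGroup_two_eq_eight (hN : N ≠ 0)
    (h8 : Nat.card ((congruentNumberCurve N).selmerGroup 2) = 8) :
    haveI := isElliptic_congruentNumberCurve hN
    (congruentNumberCurve N).mordellWeilRank = 1 ↔
      ((congruentNumberCurve N).sha ⊓ AddSubgroup.torsionBy (congruentNumberCurve N).galH1 2 :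
        AddSubgroup (congruentNumberCurve N).galH1) = ⊥ :=
  (sha_two_eq_bot_iff_mordellWeilRank_eq hN (by rw [h8]; norm_num)).symm

/-- **`#Sel⁽²⁾(E_N/ℚ) = 8`: `N` is a congruent number ⟺ `Ш(E_N)[2] = 0`** (Top–Yui: congruent ⟺ `rk ≠ 0`, and here
`rk ≤ 1`). Unconditional. [cite: TopYui2008Congruent, Prop. 3.3 (i) ⟺ (iv)] [cite: SilvermanAEC2009, Thm. X.4.2] -/
theorem isCongruentNumber_iff_sha_two_eq_bot_of_card_selmerGroup_two_eq_eight (hN : N ≠ 0)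
    (h8 : Nat.card ((congruentNumberCurve N).selmerGroup 2) = 8) :
    haveI := isElliptic_congruentNumberCurve hN
    IsCongruentNumber N ↔
      ((congruentNumberCurve N).sha ⊓ AddSubgroup.torsionBy (congruentNumberCurve N).galH1 2 :
        AddSubgroup (congruentNumberCurve N).galH1) = ⊥ := by
  haveI := isElliptic_congruentNumberCurve hN
  rw [← Wiles2000.mordellWeilRank_ne_zero_iff_isCongruentNumber (Nat.pos_of_ne_zero hN),
    ← mordellWeilRank_eq_one_iff_sha_two_eq_bot_of_card_selmerGroup_two_eq_eight hN h8]
  rcases mordellWeilRank_card_sha_two_cases_of_card_selmerGroup_two_eq_eight hN h8 with ⟨hr, -⟩ | ⟨hr, -⟩ <;>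
    simp [hr]

/-- **`#Sel⁽²⁾(E_N/ℚ) = 8`: `N` is a congruent number ⟺ `Ш(E_N)[2^∞] = 0`** (`Ш[2] = 0` kills the `2`-primary part;
a `2`-torsion element of `Ш` lies in it). Unconditional. [cite: TopYui2008Congruent, Prop. 3.3 (i) ⟺ (iv)]
[cite: SilvermanAEC2009, Thm. X.4.2] -/
theorem isCongruentNumber_iff_primaryComponent_sha_two_eq_bot_of_card_selmerGroup_two_eq_eight (hN : N ≠ 0)
    (h8 : Nat.card ((congruentNumberCurve N).selmerGroup 2) = 8) :
    haveI := isElliptic_congruentNumberCurve hN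
    IsCongruentNumber N ↔ AddCommGroup.primaryComponent (congruentNumberCurve N).sha 2 = ⊥ := by
  haveI := isElliptic_congruentNumberCurve hN
  haveI : Fact (Nat.Prime 2) := ⟨Nat.prime_two⟩
  rw [isCongruentNumber_iff_sha_two_eq_bot_of_card_selmerGroup_two_eq_eight hN h8]
  refine ⟨fun h => primaryComponent_sha_eq_bot_of_inf_torsionBy_eq_bot _ 2 (by simpa only [Nat.cast_ofNat] using h),
    fun h => ?_⟩
  rw [eq_bot_iff]
  intro x hx
  obtain ⟨hxsha, hx2⟩ := AddSubgroup.mem_inf.mp hx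
  have h2 : (2 : ℕ) • x = 0 := by
    have := AddSubgroup.torsionBy.nsmul_iff (n := 2) (x := x)
    exact this.mp (by simpa only [Nat.cast_ofNat] using hx2)
  set y : (congruentNumberCurve N).sha := ⟨x, hxsha⟩ with hy
  have hy2 : (2 : ℕ) • y = 0 := by
    apply Subtype.ext
    rw [AddSubgroupClass.coe_nsmul, ZeroMemClass.coe_zero]
    exact h2
  have hmem : y ∈ AddCommGroup.primaryComponent (congruentNumberCurve N).sha 2 := by
    rw [AddCommGroup.mem_primaryComponent]
    exact ⟨1, by rw [pow_one]; exact hy2⟩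
  rw [h, AddSubgroup.mem_bot] at hmem
  have : x = 0 := congrArg Subtype.val hmem
  rw [this]
  exact AddSubgroup.zero_mem _

/-- **`#Sel⁽²⁾(E_N/ℚ) = 8` and `N` not congruent: `rk E_N(ℚ) = 0` and `#Ш(E_N)[2] = 2`** — the other branch.
Unconditional. [cite: SilvermanAEC2009, Thm. X.4.2] [cite: TopYui2008Congruent, Prop. 3.3 (i) ⟺ (iv)] -/
theorem mordellWeilRank_eq_zero_and_card_sha_two_eq_two_of_not_isCongruentNumber (hN : N ≠ 0)
    (h8 : Nat.card ((congruentNumberCurve N).selmerGroup 2) = 8) (h : ¬ IsCongruentNumber N) :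
    haveI := isElliptic_congruentNumberCurve hN
    (congruentNumberCurve N).mordellWeilRank = 0 ∧
      Nat.card ((congruentNumberCurve N).sha ⊓ AddSubgroup.torsionBy (congruentNumberCurve N).galH1 2 :
        AddSubgroup (congruentNumberCurve N).galH1) = 2 := by
  haveI := isElliptic_congruentNumberCurve hN
  rcases mordellWeilRank_card_sha_two_cases_of_card_selmerGroup_two_eq_eight hN h8 with ⟨hr, -⟩ | hcase
  · exact absurd ((isCongruentNumber_iff_sha_two_eq_bot_of_card_selmerGroup_two_eq_eight hN h8).mpr
      ((mordellWeilRank_eq_one_iff_sha_two_eq_bot_of_card_selmerGroup_two_eq_eight hN h8).mp hr)) h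
  · exact hcase

/-! ## §3 Square-free `N ≡ 5, 6, 7 (mod 8)` with `#Sel⁽²⁾ = 8` (the root-number `−1` locus of Monsky's `s(N) = 1`) -/

/-- **For square-free `N` with `#Sel⁽²⁾(E_N/ℚ) = 8`, `Ш(E_N)[2^∞] = 0` is equivalent to `N` being congruent**, and for
`N ≡ 5, 6, 7 (mod 8)` this is the only way Monsky's `s(N)` can be `1` (the minimal value on that locus,
`MonskySelmerParity.eight_le_card_selmerGroup_two`). Restated with the square-free hypothesis for the census lane.
[cite: HeathBrown1994SelmerCongruentII, §1 typescript p. 3 L13–L16] [cite: TopYui2008Congruent, Prop. 3.3 (i) ⟺ (iv)] -/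
theorem isCongruentNumber_iff_primaryComponent_sha_two_eq_bot_of_squarefree (hN : Squarefree N)
    (h8 : Nat.card ((congruentNumberCurve N).selmerGroup 2) = 8) :
    haveI := isElliptic_congruentNumberCurve hN.ne_zero
    IsCongruentNumber N ↔ AddCommGroup.primaryComponent (congruentNumberCurve N).sha 2 = ⊥ :=
  isCongruentNumber_iff_primaryComponent_sha_two_eq_bot_of_card_selmerGroup_two_eq_eight hN.ne_zero h8

end SelmerEightShaTwo

end Literature.NumberTheory.EllipticCurves

end
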